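/-
Copyright: statement-level skeleton of a published paper (lit-balaban cell, Phase-2 proof seat p10, gen 2). No proof claims
beyond what the kernel checks below.
-/
import Mathlib
import Literature.MathematicalPhysics.QuantumFieldTheory.BalabanImbrieJaffe1984to88.BIJ85MomentumSymbols71
import Literature.MathematicalPhysics.QuantumFieldTheory.BalabanImbrieJaffe1984to88.BIJ85CurlComplement719

/-!
# `BalabanImbrieJaffe1984to88.BIJ85Tau2Kernel715` — T. Bałaban, J. Imbrie, A. Jaffe, *Renormalization of the Higgs model:
minimizers, propagators and the stability of mean field theory*, Commun. Math. Phys. **97** (1985) 299–329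
[BalabanImbrieJaffe1985]: Sect. 7.1, the τ₂ kernel (7.1.15) p. 323 as a conjugated projection, its nonnegativity, and its
value on curls — the algebra behind the explicit formula for ⟨∂B, σ_k∂B⟩ of p. 325, PROVED for generic data

statement-level skeleton of published theorems with citation tags; proofs where landed; nothing here is a claim about
the Yang–Mills mass gap

PDF held: `paper:balaban1985-cmp97-bij-higgs-minimizers` (journal page = PDF page + 298).  Renders read as images: PDF pp.
25, 27 (journal 323, 325), poppler renders in the seat folder (`renders/c2-p025.png`, `c2-p027.png`).

CITATION HEADER (lean-in-tree rule).  Part of the lit-balaban TYPED SKELETON (HOME `run/shared/lean/pub/lit-balaban/`); WHAT IS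
REPRODUCED: the generic-data half of the last step of SKELETON row **C1.Eq7.1.28-7.1.31** (*"(7.1.28)–(7.1.31), end of proof
of Thm 7.1.1"*, `HOME/lit-balaban-r15/ROWS-C1.md`, fold owner r15; p10 owns (7.1.28)–(7.1.31) of record), companion file
`BIJ85SigmaOnCurls325` carrying the specialisation to r15's symbols and the printed display of p. 325.  THE PRINTED TEXT
(p. 323 [PDF 25]): *"τ_{2,μνλκ}(p′) = (a_μā_λ(φ_νφ_κ)^{−1/2}[δ_{νκ} − (∂_ν^{(1)}\overline{∂_κ^{(1)}}/√(φ_νφ_κ))(Σ_ρ|∂_ρ^{(1)}|²/φ_ρ)^{−1}])(p′).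
(7.1.15) … In both τ₁ and τ₂ the expressions inside brackets [ ] are projection operators. Thus σ_k has the general form of a
sum of projection operators, or tensor products of projection operators, sandwiched between averaging operators."*; (p. 325
[PDF 27]): *"An explicit formula for Δ_k shows that ⟨∂B, σ_k∂B⟩ = ½(Σ_ρ|∂_ρ^{(1)}|²/φ_ρ)^{−1}Σ_{μ,ν}|(∂B)_{μν}|²/(φ_μφ_ν)."*
Inputs: the pairing (7.1.3) `BIJ85MomentumSymbols71.tensorInner` (r15, read-only) and the bracket projection
`BIJ85CurlComplement719.projK` (p10).

WHAT IS KERNEL-CHECKED (zero `sorry`, standard axioms), for GENERIC data — a one-form a = (a_μ) (the print's a(p′), (7.1.16)),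
derivative symbols e = (∂^{(1)}_μ(p′)) and weights φ = (φ_μ(p′)) > 0 with N = Σ_ρ|e_ρ|²/φ_ρ ≠ 0 — of the kernel `tau2Kernel`,
which has LITERALLY the shape of r15's `tau2Sym` (`BIJ85SigmaOnCurls325.tau2Sym_eq_kernel` is `rfl`):
 §1–§3  the τ₂-form is a norm: ⟨f, τ₂f⟩ = h̄·(W h) with h_κ = Σ_λ ā_λ f_{λκ} (`tensorInner_tau2Kernel`), W = D·P·D with
        D = diag(φ^{−1/2}) and P = `projK (e/√φ)` the orthogonal projection off ∂^{(1)}/√φ (`wMat_eq` — the bracket IS a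
        projection), hence ⟨f, τ₂f⟩ = ‖P(D h)‖² ≥ 0 for EVERY f (`tensorInner_tau2Kernel_eq_normSq`, `tau2_nonneg`);
 §4–§6  ON CURLS f = ∂B: h = S·B − β·∂^{(1)} with S = Σ_λ ā_λ∂^{(1)}_λ, the projection kills the ∂^{(1)}-part
        (`proj_scl_hVec_curl`), ‖P y‖² = ½N^{−1}Σ_{μν}|e_μy_ν − e_νy_μ|² (`normSq_projK_mulVec`, via `lagrange_identity`), so
        **⟨∂B, τ₂∂B⟩ = |S|² · ½(Σ_ρ|∂_ρ^{(1)}|²/φ_ρ)^{−1}Σ_{μν}|(∂B)_{μν}|²/(φ_μφ_ν)** (`tau2Kernel_curl`) — the printed display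
        up to the factor |S|², which `BIJ85SigmaOnCurls325` identifies with (Σ_l |u(p′+l)|²)² = 1.
Unit `lit-balaban-p10` (gen 2), HOME as above.
-/

namespace Literature.MathematicalPhysics.QuantumFieldTheory.BalabanImbrieJaffe1984to88.BIJ85Tau2Kernel715

open scoped BigOperators Real ComplexConjugate Matrix
open Finset Matrix
open Literature.MathematicalPhysics.QuantumFieldTheory.BalabanImbrieJaffe1984to88.BIJ85MomentumSymbols71
open Literature.MathematicalPhysics.QuantumFieldTheory.BalabanImbrieJaffe1984to88.BIJ85CurlComplement719

noncomputable section

variable {d : ℕ}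

/-! ## §1 The τ₂ kernel (7.1.15) for generic data: one-form a = (a_μ), derivative symbols ∂^{(1)} = (e_μ), weights φ = (φ_μ) -/

/-- N = Σ_ρ |∂^{(1)}_ρ|²/φ_ρ, the normalisation inside the bracket of (7.1.15). [cite: BalabanImbrieJaffe1985, (7.1.15) p.323] -/
def enn (e : Fin d → ℂ) (φ : Fin d → ℝ) : ℝ := ∑ ρ, ‖e ρ‖ ^ 2 / φ ρ

/-- **(7.1.15)** with generic data: τ_{2,μνλκ} = a_μā_λ(φ_νφ_κ)^{−1/2}[δ_{νκ} − e_νē_κ/√(φ_νφ_κ) N^{−1}] — literally the shape of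
r15's `tau2Sym` (`tau2Sym_eq_kernel`). [cite: BalabanImbrieJaffe1985, (7.1.15) p.323] -/
def tau2Kernel (a e : Fin d → ℂ) (φ : Fin d → ℝ) : Fin d → Fin d → Fin d → Fin d → ℂ := fun μ ν l κ =>
  a μ * conj (a l) * (((φ ν * φ κ) ^ (-(1 / 2 : ℝ)) : ℝ) : ℂ) *
    ((if ν = κ then 1 else 0) -
      e ν * conj (e κ) / ((Real.sqrt (φ ν * φ κ) : ℝ) : ℂ) * (((∑ ρ : Fin d, ‖e ρ‖ ^ 2 / φ ρ : ℝ)) : ℂ)⁻¹)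

/-- The (ν, κ) factor of (7.1.15) as a d × d matrix W_{νκ} = (φ_νφ_κ)^{−1/2}[δ_{νκ} − e_νē_κ/√(φ_νφ_κ) N^{−1}].
[cite: BalabanImbrieJaffe1985, (7.1.15) p.323] -/
def wMat (e : Fin d → ℂ) (φ : Fin d → ℝ) : Matrix (Fin d) (Fin d) ℂ := fun ν κ =>
  (((φ ν * φ κ) ^ (-(1 / 2 : ℝ)) : ℝ) : ℂ) *
    ((if ν = κ then 1 else 0) - e ν * conj (e κ) / ((Real.sqrt (φ ν * φ κ) : ℝ) : ℂ) * (((enn e φ : ℝ)) : ℂ)⁻¹)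

/-- τ_{2,μνλκ} = a_μ ā_λ W_{νκ}. [cite: BalabanImbrieJaffe1985, (7.1.15) p.323] -/
theorem tau2Kernel_eq_wMat (a e : Fin d → ℂ) (φ : Fin d → ℝ) (μ ν l κ : Fin d) :
    tau2Kernel a e φ μ ν l κ = a μ * conj (a l) * wMat e φ ν κ := by
  simp only [tau2Kernel, wMat, enn]
  ring

/-- h_κ = Σ_λ ā_λ f_{λκ}: the contraction of a two-form with ā. [cite: BalabanImbrieJaffe1985, (7.1.15) p.323] -/
def hVec (a : Fin d → ℂ) (X : Fin d → Fin d → ℂ) : Fin d → ℂ := fun κ => ∑ l, conj (a l) * X l κ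

/-- kernel: reordering a fourfold sum (μ, ν, λ, κ) ↦ (ν, κ, λ, μ). [folklore] -/
private theorem sum4_perm (F : Fin d → Fin d → Fin d → Fin d → ℂ) :
    ∑ μ, ∑ ν, ∑ l, ∑ κ, F μ ν l κ = ∑ ν, ∑ κ, ∑ l, ∑ μ, F μ ν l κ := by
  calc ∑ μ, ∑ ν, ∑ l, ∑ κ, F μ ν l κ
      = ∑ ν, ∑ μ, ∑ l, ∑ κ, F μ ν l κ := Finset.sum_comm
    _ = ∑ ν, ∑ κ, ∑ l, ∑ μ, F μ ν l κ := Finset.sum_congr rfl fun ν _ => by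
        calc ∑ μ, ∑ l, ∑ κ, F μ ν l κ
            = ∑ μ, ∑ κ, ∑ l, F μ ν l κ := Finset.sum_congr rfl fun μ _ => Finset.sum_comm
          _ = ∑ κ, ∑ μ, ∑ l, F μ ν l κ := Finset.sum_comm
          _ = ∑ κ, ∑ l, ∑ μ, F μ ν l κ := Finset.sum_congr rfl fun κ _ => Finset.sum_comm

/-- The τ₂-form factorises through h: ⟨f, τ₂f⟩ = h̄·(W h). [cite: BalabanImbrieJaffe1985, (7.1.15) p.323] -/
theorem tensorInner_tau2Kernel (a e : Fin d → ℂ) (φ : Fin d → ℝ) (X : Fin d → Fin d → ℂ) :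
    tensorInner X (tau2Kernel a e φ) X = star (hVec a X) ⬝ᵥ (wMat e φ *ᵥ hVec a X) := by
  have hR : star (hVec a X) ⬝ᵥ (wMat e φ *ᵥ hVec a X)
      = ∑ ν, ∑ κ, ∑ l, ∑ μ, conj (X μ ν) * (a μ * conj (a l) * wMat e φ ν κ) * X l κ := by
    simp only [dotProduct, Matrix.mulVec, hVec, Pi.star_apply, star_sum, star_mul', Complex.star_def,
      Complex.conj_conj, Finset.sum_mul, Finset.mul_sum]
    refine Finset.sum_congr rfl fun ν _ => Finset.sum_congr rfl fun κ _ => Finset.sum_congr rfl fun l _ =>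
      Finset.sum_congr rfl fun μ _ => ?_
    ring
  rw [hR, tensorInner, sum4_perm]
  refine Finset.sum_congr rfl fun ν _ => Finset.sum_congr rfl fun κ _ => Finset.sum_congr rfl fun l _ =>
    Finset.sum_congr rfl fun μ _ => ?_
  rw [tau2Kernel_eq_wMat]

/-! ## §2 The bracket is a projection: W = D·P·D with D = diag(φ^{−1/2}) and P the projection off ∂^{(1)}/√φ -/

/-- φ_ν^{−1/2} (as a complex number). [cite: BalabanImbrieJaffe1985, (7.1.15) p.323] -/
def sqrtInv (φ : Fin d → ℝ) (ν : Fin d) : ℂ := (((Real.sqrt (φ ν))⁻¹ : ℝ) : ℂ)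

/-- D = diag(φ_ν^{−1/2}). [cite: BalabanImbrieJaffe1985, (7.1.15) p.323] -/
def dMat (φ : Fin d → ℝ) : Matrix (Fin d) (Fin d) ℂ := Matrix.diagonal (sqrtInv φ)

/-- The rescaling x ↦ D x = (x_ν/√φ_ν)_ν. [cite: BalabanImbrieJaffe1985, (7.1.15) p.323] -/
def scl (φ : Fin d → ℝ) (x : Fin d → ℂ) : Fin d → ℂ := fun ν => sqrtInv φ ν * x ν

/-- D x = the rescaled vector. [cite: BalabanImbrieJaffe1985, (7.1.15) p.323] -/
theorem dMat_mulVec (φ : Fin d → ℝ) (x : Fin d → ℂ) : dMat φ *ᵥ x = scl φ x := by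
  funext ν
  simp [dMat, scl, Matrix.mulVec_diagonal]

/-- |φ_ν^{−1/2}|² = φ_ν^{−1} (φ_ν > 0). [folklore] [cite: BalabanImbrieJaffe1985, (7.1.15) p.323] -/
theorem norm_sqrtInv_sq {φ : Fin d → ℝ} (hφ : ∀ μ, 0 < φ μ) (ν : Fin d) : ‖sqrtInv φ ν‖ ^ 2 = (φ ν)⁻¹ := by
  rw [sqrtInv, Complex.norm_real, Real.norm_eq_abs, abs_inv, abs_of_nonneg (Real.sqrt_nonneg _), inv_pow,
    Real.sq_sqrt (hφ ν).le]

/-- |x_ν/√φ_ν|² = |x_ν|²/φ_ν (φ_ν > 0). [folklore] [cite: BalabanImbrieJaffe1985, (7.1.15) p.323] -/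
theorem norm_scl_sq {φ : Fin d → ℝ} (hφ : ∀ μ, 0 < φ μ) (x : Fin d → ℂ) (ν : Fin d) :
    ‖scl φ x ν‖ ^ 2 = ‖x ν‖ ^ 2 / φ ν := by
  rw [scl, norm_mul, mul_pow, norm_sqrtInv_sq hφ, inv_mul_eq_div]

/-- Σ_ρ |e_ρ/√φ_ρ|² = N. [cite: BalabanImbrieJaffe1985, (7.1.15) p.323] -/
theorem sum_norm_scl_sq {φ : Fin d → ℝ} (hφ : ∀ μ, 0 < φ μ) (e : Fin d → ℂ) :
    ∑ ρ, ‖scl φ e ρ‖ ^ 2 = enn e φ := by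
  unfold enn
  exact Finset.sum_congr rfl fun ρ _ => norm_scl_sq hφ e ρ

/-- kernel: (φ_νφ_κ)^{−1/2} = (√φ_ν √φ_κ)^{−1}. [folklore] -/
private theorem rpow_neg_half_mul {φ : Fin d → ℝ} (hφ : ∀ μ, 0 < φ μ) (ν κ : Fin d) :
    (φ ν * φ κ) ^ (-(1 / 2 : ℝ)) = (Real.sqrt (φ ν) * Real.sqrt (φ κ))⁻¹ := by
  rw [Real.rpow_neg (mul_pos (hφ ν) (hφ κ)).le, ← Real.sqrt_eq_rpow, Real.sqrt_mul (hφ ν).le]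

/-- **W = D P D**: the (ν, κ) factor of (7.1.15) is the projection `projK (∂^{(1)}/√φ)` conjugated by D = diag(φ^{−1/2}) — the
print's *"the expressions inside brackets [ ] are projection operators"* for τ₂. [cite: BalabanImbrieJaffe1985, (7.1.15) p.323] -/
theorem wMat_eq {e : Fin d → ℂ} {φ : Fin d → ℝ} (hφ : ∀ μ, 0 < φ μ) (hN : enn e φ ≠ 0) :
    wMat e φ = dMat φ * projK (scl φ e) * dMat φ := by
  ext ν κ
  rw [dMat, Matrix.mul_diagonal, Matrix.diagonal_mul, projK_apply, sum_norm_scl_sq hφ, wMat, rpow_neg_half_mul hφ,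
    Real.sqrt_mul (hφ ν).le]
  have hs : (Real.sqrt (φ ν) : ℂ) ≠ 0 := Complex.ofReal_ne_zero.mpr (Real.sqrt_pos.mpr (hφ ν)).ne'
  have ht : (Real.sqrt (φ κ) : ℂ) ≠ 0 := Complex.ofReal_ne_zero.mpr (Real.sqrt_pos.mpr (hφ κ)).ne'
  have hN' : ((enn e φ : ℝ) : ℂ) ≠ 0 := Complex.ofReal_ne_zero.mpr hN
  simp only [scl, sqrtInv, map_mul, Complex.conj_ofReal]
  push_cast
  field_simp

/-! ## §3 The τ₂-form is a norm: ⟨f, τ₂f⟩ = ‖P(D h)‖² ≥ 0 -/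

/-- kernel: for a self-adjoint idempotent matrix M, x̄·(Mx) = |Mx|². [folklore] -/
private theorem star_dot_mulVec_of_proj {ι : Type*} [Fintype ι] [DecidableEq ι] (M : Matrix ι ι ℂ) (hM : Mᴴ = M)
    (hM2 : M * M = M) (x : ι → ℂ) :
    star x ⬝ᵥ (M *ᵥ x) = ((∑ i, ‖(M *ᵥ x) i‖ ^ 2 : ℝ) : ℂ) := by
  have h : star x ⬝ᵥ (M *ᵥ x) = star (M *ᵥ x) ⬝ᵥ (M *ᵥ x) := by
    rw [Matrix.star_mulVec, hM, ← Matrix.dotProduct_mulVec, Matrix.mulVec_mulVec, hM2]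
  rw [h]
  simp only [dotProduct, Pi.star_apply, Complex.star_def, Complex.conj_mul']
  push_cast
  rfl

/-- kernel: D is real diagonal, so x̄·(D y) = \overline{(D x)}·y. [folklore] -/
private theorem star_dot_dMat_mulVec (φ : Fin d → ℝ) (x y : Fin d → ℂ) :
    star x ⬝ᵥ (dMat φ *ᵥ y) = star (dMat φ *ᵥ x) ⬝ᵥ y := by
  rw [dMat_mulVec, dMat_mulVec]
  simp only [dotProduct, scl, sqrtInv, Pi.star_apply, Complex.star_def, map_mul, Complex.conj_ofReal]
  exact Finset.sum_congr rfl fun i _ => by ring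

/-- **⟨f, τ₂f⟩ = ‖P(D h)‖²** for every two-form f (φ > 0, N ≠ 0): the τ₂-form is the squared norm of the projection, off
∂^{(1)}/√φ, of the rescaled contraction D h, h_κ = Σ_λ ā_λ f_{λκ}. [cite: BalabanImbrieJaffe1985, (7.1.15) p.323] -/
theorem tensorInner_tau2Kernel_eq_normSq {e : Fin d → ℂ} {φ : Fin d → ℝ} (hφ : ∀ μ, 0 < φ μ) (hN : enn e φ ≠ 0)
    (a : Fin d → ℂ) (X : Fin d → Fin d → ℂ) :
    tensorInner X (tau2Kernel a e φ) X =
      ((∑ i, ‖(projK (scl φ e) *ᵥ (scl φ (hVec a X))) i‖ ^ 2 : ℝ) : ℂ) := by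
  rw [tensorInner_tau2Kernel, wMat_eq hφ hN, ← Matrix.mulVec_mulVec, ← Matrix.mulVec_mulVec, star_dot_dMat_mulVec,
    star_dot_mulVec_of_proj _ (projK_conjTranspose _) (projK_mul_projK _), dMat_mulVec]

/-- Hence τ₂ ≥ 0 as a form on all two-forms (a real, nonnegative number) — the (7.1.15)-part of p. 323's *"σ_k has the
general form of a sum of projection operators … sandwiched between averaging operators"*. [cite: BalabanImbrieJaffe1985, (7.1.15) p.323] -/
theorem tau2_nonneg {e : Fin d → ℂ} {φ : Fin d → ℝ} (hφ : ∀ μ, 0 < φ μ) (hN : enn e φ ≠ 0)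
    (a : Fin d → ℂ) (X : Fin d → Fin d → ℂ) :
    0 ≤ (tensorInner X (tau2Kernel a e φ) X).re ∧ (tensorInner X (tau2Kernel a e φ) X).im = 0 := by
  rw [tensorInner_tau2Kernel_eq_normSq hφ hN, Complex.ofReal_re, Complex.ofReal_im]
  exact ⟨by positivity, rfl⟩

/-! ## §4 On curls: h = S·B − β·∂^{(1)}, and the projection kills the ∂^{(1)}-part -/

/-- S = Σ_λ ā_λ e_λ, the pairing of ā with ∂^{(1)}. [cite: BalabanImbrieJaffe1985, (7.1.16) p.323] -/
def aPair (a e : Fin d → ℂ) : ℂ := ∑ l, conj (a l) * e l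

/-- For a curl f = ∂B (`curlP e B`, f_{λκ} = e_λB_κ − e_κB_λ): h = S·B − (Σ_λ ā_λB_λ)·e.
[cite: BalabanImbrieJaffe1985, (7.1.31) p.325] -/
theorem hVec_curl (a e B : Fin d → ℂ) :
    hVec a (curlP e B) = aPair a e • B - aPair a B • e := by
  funext κ
  simp only [hVec, curlP, aPair, Pi.sub_apply, Pi.smul_apply, smul_eq_mul, mul_sub, Finset.sum_sub_distrib,
    Finset.sum_mul]
  congr 1
  · exact Finset.sum_congr rfl fun l _ => by ring
  · exact Finset.sum_congr rfl fun l _ => by ring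

/-- The rescaling is linear: D(S·B − β·e) = S·(DB) − β·(De). [folklore] -/
private theorem scl_sub_smul (φ : Fin d → ℝ) (S β : ℂ) (B e : Fin d → ℂ) :
    scl φ (S • B - β • e) = S • scl φ B - β • scl φ e := by
  funext ν
  simp only [scl, Pi.sub_apply, Pi.smul_apply, smul_eq_mul]
  ring

/-- The bracket kills its own vector: P_e e = 0 (Σ|e_ρ|² ≠ 0). [cite: BalabanImbrieJaffe1985, (7.1.15) p.323] -/
theorem projK_mulVec_self {e : Fin d → ℂ} (he : (∑ ρ, ‖e ρ‖ ^ 2) ≠ 0) : projK e *ᵥ e = 0 := by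
  have hN : (((∑ ρ, ‖e ρ‖ ^ 2 : ℝ)) : ℂ) ≠ 0 := Complex.ofReal_ne_zero.mpr he
  have hsum : ∑ l, conj (e l) * e l = (((∑ ρ, ‖e ρ‖ ^ 2 : ℝ)) : ℂ) := by
    push_cast
    exact Finset.sum_congr rfl fun l _ => Complex.conj_mul' (e l)
  funext i
  simp only [Matrix.mulVec, dotProduct, projK_apply, sub_mul, Finset.sum_sub_distrib, Pi.zero_apply]
  simp only [ite_mul, one_mul, zero_mul, Finset.sum_ite_eq, Finset.mem_univ, if_true]
  have h2 : ∑ x, e i * conj (e x) / (((∑ ρ, ‖e ρ‖ ^ 2 : ℝ)) : ℂ) * e x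
      = e i * (∑ l, conj (e l) * e l) / (((∑ ρ, ‖e ρ‖ ^ 2 : ℝ)) : ℂ) := by
    rw [Finset.mul_sum, Finset.sum_div]
    exact Finset.sum_congr rfl fun l _ => by ring
  rw [h2, hsum, mul_div_assoc, div_self hN, mul_one, sub_self]

/-- On a curl the projected rescaled contraction is S·P(DB): the ∂^{(1)}-component drops out (*"since … f^⊥ is defined with
respect to the inner product (7.1.19b), … the ∂ terms vanish"*, here for τ₂). [cite: BalabanImbrieJaffe1985, (7.1.31) p.325] -/
theorem proj_scl_hVec_curl {e : Fin d → ℂ} {φ : Fin d → ℝ} (hφ : ∀ μ, 0 < φ μ) (hN : enn e φ ≠ 0) (a B : Fin d → ℂ) :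
    projK (scl φ e) *ᵥ (scl φ (hVec a (curlP e B))) = aPair a e • (projK (scl φ e) *ᵥ scl φ B) := by
  have he : (∑ ρ, ‖scl φ e ρ‖ ^ 2) ≠ 0 := by rwa [sum_norm_scl_sq hφ]
  rw [hVec_curl, scl_sub_smul, Matrix.mulVec_sub, Matrix.mulVec_smul, Matrix.mulVec_smul, projK_mulVec_self he,
    smul_zero, sub_zero]

/-! ## §5 The value of ‖P y‖²: the Lagrange identity -/

/-- kernel: ȳ·(P y) = Σ|y_ν|² − |Σ_κ ē_κy_κ|²/N written in ℂ. [folklore] -/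
private theorem star_dot_projK_mulVec (e y : Fin d → ℂ) :
    star y ⬝ᵥ (projK e *ᵥ y) = (∑ ν, conj (y ν) * y ν)
      - (∑ ν, conj (y ν) * e ν) * (∑ κ, conj (e κ) * y κ) / (((∑ ρ, ‖e ρ‖ ^ 2 : ℝ)) : ℂ) := by
  simp only [dotProduct, Matrix.mulVec, Pi.star_apply, Complex.star_def, projK_apply, sub_mul, Finset.sum_sub_distrib,
    Finset.mul_sum, ite_mul, one_mul, zero_mul, Finset.sum_ite_eq, Finset.mem_univ, if_true, mul_sub]
  congr 1
  rw [Finset.sum_div]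
  calc ∑ ν, ∑ κ, conj (y ν) * (e ν * conj (e κ) / (((∑ ρ, ‖e ρ‖ ^ 2 : ℝ)) : ℂ) * y κ)
      = ∑ κ, ∑ ν, conj (y ν) * (e ν * conj (e κ) / (((∑ ρ, ‖e ρ‖ ^ 2 : ℝ)) : ℂ) * y κ) := Finset.sum_comm
    _ = _ := Finset.sum_congr rfl fun κ _ => by
        rw [Finset.sum_mul, Finset.sum_div]
        exact Finset.sum_congr rfl fun ν _ => by ring

/-- **Lagrange's identity** (complex form): Σ_{μν}|e_μy_ν − e_νy_μ|² = 2(Σ|e_μ|²·Σ|y_ν|² − |Σ_κ ē_κy_κ|²), in ℂ.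
[folklore] [cite: BalabanImbrieJaffe1985, (7.1.31) p.325] -/
theorem lagrange_identity (e y : Fin d → ℂ) :
    (∑ μ, ∑ ν, (e μ * y ν - e ν * y μ) * conj (e μ * y ν - e ν * y μ))
      = 2 * ((∑ μ, conj (e μ) * e μ) * (∑ ν, conj (y ν) * y ν)
          - (∑ ν, conj (y ν) * e ν) * (∑ κ, conj (e κ) * y κ)) := by
  have hsplit : ∀ μ ν, (e μ * y ν - e ν * y μ) * conj (e μ * y ν - e ν * y μ)
      = (conj (e μ) * e μ) * (conj (y ν) * y ν) + (conj (e ν) * e ν) * (conj (y μ) * y μ)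
        - (conj (y μ) * e μ) * (conj (e ν) * y ν) - (conj (y ν) * e ν) * (conj (e μ) * y μ) := by
    intro μ ν
    simp only [map_sub, map_mul]
    ring
  simp_rw [hsplit]
  simp only [Finset.sum_sub_distrib, Finset.sum_add_distrib]
  rw [← Finset.sum_mul_sum, ← Finset.sum_mul_sum]
  have h4 : ∑ μ, ∑ ν, (conj (e ν) * e ν) * (conj (y μ) * y μ) = (∑ ν, conj (e ν) * e ν) * ∑ μ, conj (y μ) * y μ := by
    rw [Finset.sum_mul_sum]
    exact Finset.sum_comm
  have h5 : ∑ μ, ∑ ν, (conj (y ν) * e ν) * (conj (e μ) * y μ) = (∑ ν, conj (y ν) * e ν) * ∑ μ, conj (e μ) * y μ := by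
    rw [Finset.sum_mul_sum]
    exact Finset.sum_comm
  rw [h4, h5]
  ring

/-- **‖P y‖² = ½N^{−1}Σ_{μν}|e_μy_ν − e_νy_μ|²** for the projection off e (N = Σ|e_ρ|² ≠ 0).
[cite: BalabanImbrieJaffe1985, (7.1.31) p.325] -/
theorem normSq_projK_mulVec {e : Fin d → ℂ} (he : (∑ ρ, ‖e ρ‖ ^ 2) ≠ 0) (y : Fin d → ℂ) :
    (∑ i, ‖(projK e *ᵥ y) i‖ ^ 2) = 1 / 2 * (∑ ρ, ‖e ρ‖ ^ 2)⁻¹ * ∑ μ, ∑ ν, ‖e μ * y ν - e ν * y μ‖ ^ 2 := by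
  have hN : (((∑ ρ, ‖e ρ‖ ^ 2 : ℝ)) : ℂ) ≠ 0 := Complex.ofReal_ne_zero.mpr he
  apply Complex.ofReal_injective
  rw [← star_dot_mulVec_of_proj _ (projK_conjTranspose _) (projK_mul_projK _), star_dot_projK_mulVec]
  have hee : (∑ μ, conj (e μ) * e μ) = (((∑ ρ, ‖e ρ‖ ^ 2 : ℝ)) : ℂ) := by
    push_cast
    exact Finset.sum_congr rfl fun l _ => Complex.conj_mul' (e l)
  have hsq : (((∑ μ, ∑ ν, ‖e μ * y ν - e ν * y μ‖ ^ 2 : ℝ)) : ℂ)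
      = ∑ μ, ∑ ν, (e μ * y ν - e ν * y μ) * conj (e μ * y ν - e ν * y μ) := by
    push_cast
    exact Finset.sum_congr rfl fun μ _ => Finset.sum_congr rfl fun ν _ => (Complex.mul_conj' _).symm
  rw [Complex.ofReal_mul, Complex.ofReal_mul, Complex.ofReal_inv, Complex.ofReal_div, Complex.ofReal_one,
    Complex.ofReal_ofNat, hsq, lagrange_identity, hee]
  field_simp

/-! ## §6 The explicit formula on curls, generic data -/

/-- On curls the rescaled components: (e_μB_ν − e_νB_μ)/(√φ_μ√φ_ν) with |·|² = |(∂B)_{μν}|²/(φ_μφ_ν).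
[cite: BalabanImbrieJaffe1985, (7.1.31) p.325] -/
theorem norm_scl_curl_sq {φ : Fin d → ℝ} (hφ : ∀ μ, 0 < φ μ) (e B : Fin d → ℂ) (μ ν : Fin d) :
    ‖scl φ e μ * scl φ B ν - scl φ e ν * scl φ B μ‖ ^ 2 = ‖curlP e B μ ν‖ ^ 2 / (φ μ * φ ν) := by
  have h : scl φ e μ * scl φ B ν - scl φ e ν * scl φ B μ = sqrtInv φ μ * sqrtInv φ ν * curlP e B μ ν := by
    simp only [scl, curlP]
    ring
  rw [h, norm_mul, norm_mul, mul_pow, mul_pow, norm_sqrtInv_sq hφ, norm_sqrtInv_sq hφ]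
  have hμ := (hφ μ).ne'
  have hν := (hφ ν).ne'
  field_simp

/-- **⟨∂B, τ₂∂B⟩ = |S|² · ½N^{−1}Σ_{μν}|(∂B)_{μν}|²/(φ_μφ_ν)**, S = Σ_λ ā_λe_λ, N = Σ_ρ|e_ρ|²/φ_ρ — exact, for generic data with
φ > 0 and N ≠ 0. [cite: BalabanImbrieJaffe1985, (7.1.31) p.325] -/
theorem tau2Kernel_curl {e : Fin d → ℂ} {φ : Fin d → ℝ} (hφ : ∀ μ, 0 < φ μ) (hN : enn e φ ≠ 0) (a B : Fin d → ℂ) :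
    tensorInner (curlP e B) (tau2Kernel a e φ) (curlP e B) =
      ((‖aPair a e‖ ^ 2 * (1 / 2 * (enn e φ)⁻¹ * ∑ μ, ∑ ν, ‖curlP e B μ ν‖ ^ 2 / (φ μ * φ ν)) : ℝ) : ℂ) := by
  have he : (∑ ρ, ‖scl φ e ρ‖ ^ 2) ≠ 0 := by rwa [sum_norm_scl_sq hφ]
  rw [tensorInner_tau2Kernel_eq_normSq hφ hN, proj_scl_hVec_curl hφ hN]
  congr 1
  simp only [Pi.smul_apply, smul_eq_mul, norm_mul, mul_pow]
  rw [← Finset.mul_sum, normSq_projK_mulVec he, sum_norm_scl_sq hφ]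
  congr 1
  congr 1
  exact Finset.sum_congr rfl fun μ _ => Finset.sum_congr rfl fun ν _ => norm_scl_curl_sq hφ e B μ ν

end

end Literature.MathematicalPhysics.QuantumFieldTheory.BalabanImbrieJaffe1984to88.BIJ85Tau2Kernel715
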